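import Literature.AnabelianGeometry.EtaleTheta.Discharge.Sec4Prop42SubZetaA
import Literature.AnabelianGeometry.EtaleTheta.Discharge.Sec4Prop42SubRootPair
import HarnessLib

/-!
# [EtTh] Prop. 4.2 (iv), sub-node L05 `UnitRootsUpstairs`: reduced to the «roots of constants» law of
# [FrdII] Rmk. 2.2.1 + [EtTh] Prop. 3.4 (ii) at the `(N, H_⊙^{bs-fld})`-saturated object of Def. 4.1 (iii)(a)

Mochizuki, *The étale theta function and its Frobenioid-theoretic manifestations*, Publ. RIMS **45**
(2009), §4, Prop. 4.2 (iv), proof PDF p.90 L14–17 [cite: MochizukiEtTh2009, Prop 4.2 p.90]: «it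
follows from the "(N, H_⊙, f|_{A_N})-saturated-ness" condition in the statement of assertion (iii)
[cf. also Proposition 3.4, (ii)] that the pull-back `∈ O^×(A_N)` or `∈ O^×(Ā_N)` of any element
`∈ O^×(A_⊙)` [i.e., via the "pull-back portion" of `α, ᾱ` — cf. Definition 4.1, (iv), (d)] admits an
`N`-th root». PROOF-ONLY file (abc-iut cell, writer abc-iut-w4-d044; node `EtTh:Prop4.2(iv)`, sub-DAG
row `EtTh:Prop4.2(iv)/L05` of `plan/L2/SUBDAG-EtTh-Prop42.md`, owner ∅) over abc-iut-w5-d134's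
`Prop42Sub.lean`, abc-iut-L2-t3's `BiKummerSetting`, abc-iut-L2-t9's `mkOfModelCanonical`, and the
[FrdI] Thm. 5.2 model-Frobenioid bookkeeping of layer L1 (`ModelFrobenioid.unitAut`,
`unitsToRatFn_injective`, `divB_unitsToRatFn_eq_one`). Nothing there is edited; no definition and no
named fact is introduced.

**The cut.** The typed L05 quantifies over an `N`-th root `R` (which carries the saturation of Def.
4.1 (iii): (a) pre-steps `A₁ → A_N`, `A₁ → A''` with `A''` Frobenius-trivial and
`(N, H_⊙^{bs-fld})`-saturated in `C^{bs-fld}` — the FREE field `IsNHSaturatedBsFld` of the setting,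
[FrdII] Def. 2.2 (ii), TODO-merge abc-iut-L1-t4). In the model Frobenioid the printed sentence splits
into
* a TRANSPORT step (this file, PROVED): units of `A_N`, `A₁`, `A''` live in `Ker(Div_B) ⊆ B(−)` and
  move along the base isomorphisms of the two pre-steps ([FrdI] Thm. 5.2 (ii) "`O^×(−)` on `C^birat` is
  `B`"); a unit `x'` of `A_N` over the unit `x` of `A_⊙` has `u_{x'} = Base(α')^* u_x`; an `N`-th root
  `ζ ∈ B(Base A'')` of the pull-back of `u_x` to `A''` gives, transported back, a unit `y` of `A_N` with
  `yᴺ = x'` (torsion-freeness of `Φ^gp` for `Div_B(y) = 0`; injectivity of `O^×(A_N) → B(Base A_N)`);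
* the ARITHMETIC law (hypothesis `hL` below, NOT provable over the free field): «for a Frobenius-trivial,
  `(N, H_⊙^{bs-fld})`-saturated `A''` and any `g : Base(A'') → Base(A_⊙)` in `D`, every `ξ ∈ B(Base A_⊙)`
  with `Div_B(ξ) = 0` has an `N`-th root in `B(Base A'')` after pull-back along `g`» — i.e. [EtTh]
  Prop. 3.4 (ii) (`Ker(B → Φ^gp) = O_L^×`: units are constants) + [FrdII] Rmk. 2.2.1 (condition (c) of
  Def. 2.2 (ii) makes `Ker(H ↠ H_A)` fix the `N`-th roots of `H`-invariant units; tree, layer L1: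
  `PadicKummer.Def22Context.smul_eq_of_isNHSaturated`, `InvariantsAdmitRoots`). This law is the EXACT
  statement the `C^{bs-fld}`-identification (TODO-merge abc-iut-L1-t4) must supply for Prop. 4.2 (iv);
  it is recorded on the cell's GAP-LEDGER (row G-w4d044-1).

**Results**: `Prop42Sub.unitRootsUpstairs_of_constantRoots` (every setting, modulo `Φ` divisorial, `B`
group-like, `hL`); with `Sec4Prop42SubZetaA.lean`: `zetaA_of_constantRoots`, and for the canonical model
instance `prop42_iv_mkOfModelCanonical_of_constantRoots` — **[EtTh] Prop. 4.2 (iv) AS TYPED at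
`mkOfModelCanonical` holds modulo `Φ` divisorial and the single law `hL` on the free `(N, H)`-saturation
field `NH`.** HONEST FRAMING: [EtTh]/[FrdII] are refereed prerequisites; typed ≠ proved for `hL`; nothing
here takes a side on [IUTchIII] Cor. 3.12.
-/

namespace Literature.AnabelianGeometry.EtaleTheta

open CategoryTheory Opposite Literature.AlgebraicGeometry.Frobenioids

universe u₀ v₀ u v w

variable {K : Type u₀} [Field K]

namespace BiKummerSetting

variable {X : SemiGraphs.TemperedArithmeticGroup.{u₀} K} {D₀ : Type u₀} [Category.{v₀} D₀]
  {V : FrdIMonoidStub.{w}} {T : RealifiedDivisorMonoids (D₀ := D₀) V} {D : Type u} [Category.{v} D]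
  {VD : FrdICatStub.{u, v, w} D} (S : BiKummerSetting X T D VD)

namespace Prop42Sub

variable (pullFrac : ∀ {A A' : S.C} (_ : A' ⟶ A), S.biratUnits A → S.biratUnits A')

/-- **(iv)/L05 `UnitRootsUpstairs` reduced to the roots-of-constants law** (modulo `Φ` divisorial, `B`
group-like): the transport half of the printed sentence p.90 L14–17 is proved in the model Frobenioid,
the arithmetic half enters as `hL` (see the module docstring). [cite: MochizukiEtTh2009, Prop 4.2 p.90] -/
theorem unitRootsUpstairs_of_constantRoots
    (hΦd : Objectwise (fun M _ => IsDivisorial M) S.tf.divisorMonoid)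
    (hBg : Objectwise (fun M _ => IsGroupLike M) S.tf.ratFnFunctor)
    (hL : ∀ (A'' : S.C) (N : ℕ+) (g : A''.base ⟶ S.Aodot.base)
      (ξ : S.tf.ratFnFunctor.obj (op S.Aodot.base)),
      S.IsFrobeniusTrivial A'' → S.IsNHSaturatedBsFld S.HodotBsFld A'' N →
      divB S.tf.divisorMonoid S.tf.ratFnFunctor S.tf.divBNatTrans (op S.Aodot.base) ξ = 1 →
        ∃ ζ : S.tf.ratFnFunctor.obj (op A''.base), ζ ^ (N : ℕ) = pull S.tf.ratFnFunctor g ξ) :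
    UnitRootsUpstairs S pullFrac := by
  intro B f P N R x x' hx hx' hover
  -- Def. 4.1 (iii)(a) for `A_N`: pre-steps `s₁ : A₁ → A_N`, `s₂ : A₁ → A''`
  obtain ⟨A₁, A'', s₁, s₂, hs₁, hs₂, hft, hNH⟩ := R.isSaturated.cond_a
  haveI : IsIso (ModelFrobenioid.baseMap s₁) := hs₁.2
  haveI : IsIso (ModelFrobenioid.baseMap s₂) := hs₂.2
  have hxm : x ∈ ModelFrobenioid.units S.Aodot := ⟨hx.1, hx.2⟩
  have hx'm : x' ∈ ModelFrobenioid.units R.AN := ⟨hx'.1, hx'.2⟩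
  -- integrality / cancellation
  have hint : IsIntegral (S.tf.divisorMonoid.obj (op R.AN.base)) := (hΦd R.AN.base).isPreDivisorial.isIntegral
  haveI : IsCancelMul (S.tf.ratFnFunctor.obj (op R.AN.base)) :=
    isIntegral_iff_isCancelMul.mp (hBg R.AN.base).isPreDivisorial.isIntegral
  -- the unit `ξ := u_x` of `A_⊙`, with `Div_B(ξ) = 0`
  set ξ := ModelFrobenioid.unit x.hom with hξ_def
  have hξ : divB S.tf.divisorMonoid S.tf.ratFnFunctor S.tf.divBNatTrans (op S.Aodot.base) ξ = 1 :=
    ModelFrobenioid.divB_unitsToRatFn_eq_one (hΦd S.Aodot.base).isSharp ⟨x, hxm⟩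
  -- `x'` lies over `x` along `α'`: `u_{x'} = Base(α')^* ξ`
  have hp₁ := ModelFrobenioid.degFr_div_of_isPullbackMorphism hΦd R.αData.cond_d
  have hux' : ModelFrobenioid.unit x'.hom =
      pull S.tf.ratFnFunctor (ModelFrobenioid.baseMap R.αData.α₁) ξ := by
    have h := congrArg ModelFrobenioid.unit hover
    rw [ModelFrobenioid.unit_comp_pull, ModelFrobenioid.unit_comp_pull, hx'm.1, pull_id, hp₁.1,
      hxm.2, PNat.one_coe, pow_one, pow_one, mul_comm] at h
    exact mul_right_cancel h
  -- the law at `A''` along `g := Base(s₂)⁻¹ ≫ Base(s₁) ≫ Base(α')`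
  let b₁ := ModelFrobenioid.baseMap s₁
  let b₂ := ModelFrobenioid.baseMap s₂
  obtain ⟨ζ, hζ⟩ := hL A'' N (inv b₂ ≫ b₁ ≫ ModelFrobenioid.baseMap R.αData.α₁) ξ hft hNH hξ
  -- transport `ζ` to `B(Base A_N)`: `w := Base(s₁)⁻¹^* Base(s₂)^* ζ`, with `w^N = u_{x'}`
  set w : S.tf.ratFnFunctor.obj (op R.AN.base) :=
    pull S.tf.ratFnFunctor (inv b₁) (pull S.tf.ratFnFunctor b₂ ζ) with hw_def
  have hwN : w ^ (N : ℕ) = ModelFrobenioid.unit x'.hom := by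
    rw [hw_def, ← map_pow, ← map_pow, hζ, ← pull_comp, ← pull_comp, Category.assoc,
      IsIso.hom_inv_id_assoc, IsIso.inv_hom_id_assoc, hux']
  -- `Div_B(w) = 0` (torsion-freeness of `Φ^gp`)
  have hdw : divB S.tf.divisorMonoid S.tf.ratFnFunctor S.tf.divBNatTrans (op R.AN.base) w = 1 := by
    apply gp_pow_injective_of_isDivisorial (hΦd R.AN.base) N
    rw [one_pow, ← map_pow, hwN]
    exact ModelFrobenioid.divB_unitsToRatFn_eq_one (hΦd R.AN.base).isSharp ⟨x', hx'm⟩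
  -- the unit `y := (1, id, 0, w)` of `A_N`
  obtain ⟨wu, hwu⟩ := (hBg R.AN.base).isUnit w
  have h1 : Algebra.GrothendieckGroup.of (1 : S.tf.divisorMonoid.obj (op R.AN.base)) =
      divB S.tf.divisorMonoid S.tf.ratFnFunctor S.tf.divBNatTrans (op R.AN.base) w := by
    rw [map_one, hdw]
  have h1' : Algebra.GrothendieckGroup.of (1 : S.tf.divisorMonoid.obj (op R.AN.base)) =
      divB S.tf.divisorMonoid S.tf.ratFnFunctor S.tf.divBNatTrans (op R.AN.base) ↑wu⁻¹ := by
    have h : divB S.tf.divisorMonoid S.tf.ratFnFunctor S.tf.divBNatTrans (op R.AN.base) ↑wu⁻¹ *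
        divB S.tf.divisorMonoid S.tf.ratFnFunctor S.tf.divBNatTrans (op R.AN.base) w = 1 := by
      rw [← map_mul, ← hwu, Units.inv_mul, map_one]
    rw [hdw, mul_one] at h
    rw [map_one, h]
  let y : Aut R.AN := ModelFrobenioid.unitAut R.AN 1 1 w ↑wu⁻¹ h1 h1' (mul_one 1)
    (by rw [← hwu, Units.inv_mul])
  have hy : y ∈ ModelFrobenioid.units R.AN := ModelFrobenioid.unitAut_mem_units _ _ _ _ _ _ _ _ _
  refine ⟨y, ⟨hy.1, hy.2⟩, ?_⟩
  -- `yᴺ = x'`: both are units of `A_N` with the same image `wᴺ = u_{x'}` in `B(Base A_N)`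
  have hinj := ModelFrobenioid.unitsToRatFn_injective (X := R.AN) hint
  have key : (⟨y, hy⟩ : ModelFrobenioid.units R.AN) ^ (N : ℕ) = ⟨x', hx'm⟩ := by
    apply hinj
    apply Units.ext
    rw [map_pow, Units.val_pow_eq_pow_val, ModelFrobenioid.coe_unitsToRatFn,
      ModelFrobenioid.coe_unitsToRatFn]
    exact hwN
  exact congrArg Subtype.val key

/-- **(iv)/L06 `ZetaA` from the roots-of-constants law** (via `zetaA_of_unitRootsUpstairs`), for every
setting whose Def. 4.1 (iv)(e) predicate implies the canonical reading.
[cite: MochizukiEtTh2009, Prop 4.2 p.90] -/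
theorem zetaA_of_constantRoots (hΦd : Objectwise (fun M _ => IsDivisorial M) S.tf.divisorMonoid)
    (hBg : Objectwise (fun M _ => IsGroupLike M) S.tf.ratFnFunctor)
    (hE : ∀ {A B : S.C} (G : Subgroup (Aut A)) (α₂ : A ⟶ A) (α₁ : A ⟶ B),
      S.ArisesFromBaseFrobeniusPair G α₂ α₁ → S.tf.ArisesFromBaseFrobeniusPair G α₂ α₁)
    (hL : ∀ (A'' : S.C) (N : ℕ+) (g : A''.base ⟶ S.Aodot.base)
      (ξ : S.tf.ratFnFunctor.obj (op S.Aodot.base)),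
      S.IsFrobeniusTrivial A'' → S.IsNHSaturatedBsFld S.HodotBsFld A'' N →
      divB S.tf.divisorMonoid S.tf.ratFnFunctor S.tf.divBNatTrans (op S.Aodot.base) ξ = 1 →
        ∃ ζ : S.tf.ratFnFunctor.obj (op A''.base), ζ ^ (N : ℕ) = pull S.tf.ratFnFunctor g ξ) :
    ZetaA S pullFrac :=
  zetaA_of_unitRootsUpstairs S pullFrac hΦd hBg hE
    (unitRootsUpstairs_of_constantRoots S pullFrac hΦd hBg hL)

end Prop42Sub

section Canonical

variable (X) (tf : TemperedFrobenioid T D VD) (hZ : tf.monoidType = MonoidType.Z)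
  (hP : ∀ A : Dᵒᵖ, IsPerfect (tf.Φ.carrier A)) (IG : D → Prop) (gS : ∀ A : D, IG A → (X.Pi →* Aut A))
  (gSs : ∀ (A : D) (h : IG A), Function.Surjective (gS A h))
  (NH : Subgroup (Field.absoluteGaloisGroup K) → tf.category → ℕ+ → Prop) (A₀ : tf.category)
  (hA₀ : PreFrobenioid.IsFrobeniusTrivial tf.toElem A₀) (hA₀' : IG A₀.base)

/-- **[EtTh] Prop. 4.2 (iv) AS TYPED for the CANONICAL MODEL INSTANCE, modulo `Φ` divisorial and the
roots-of-constants law for the chosen `(N, H)`-saturation predicate `NH`** ([FrdII] Rmk. 2.2.1 + [EtTh]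
Prop. 3.4 (ii); the exact interface statement owed by the `C^{bs-fld}` identification): L05 by
`unitRootsUpstairs_of_constantRoots`, L06 by `zetaA_of_unitRootsUpstairs`, the rest by abc-iut-w5-d134's
`prop42_iv_mkOfModel_of_zetaA`. [cite: MochizukiEtTh2009, Prop 4.2 p.89] -/
theorem prop42_iv_mkOfModelCanonical_of_constantRoots
    (hΦd : Objectwise (fun M _ => IsDivisorial M) tf.divisorMonoid)
    (hL : ∀ (A'' : tf.category) (N : ℕ+) (g : A''.base ⟶ A₀.base)
      (ξ : tf.ratFnFunctor.obj (op A₀.base)),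
      PreFrobenioid.IsFrobeniusTrivial tf.toElem A'' →
      NH (mkOfModelCanonical X tf hZ hP IG gS gSs NH A₀ hA₀ hA₀').HodotBsFld A'' N →
      divB tf.divisorMonoid tf.ratFnFunctor tf.divBNatTrans (op A₀.base) ξ = 1 →
        ∃ ζ : tf.ratFnFunctor.obj (op A''.base), ζ ^ (N : ℕ) = pull tf.ratFnFunctor g ξ) :
    (mkOfModelCanonical X tf hZ hP IG gS gSs NH A₀ hA₀ hA₀').Prop42_iv (fun φ x => tf.pullFracModel φ x) :=
  prop42_iv_mkOfModelCanonical_of_unitRootsUpstairs X tf hZ hP IG gS gSs NH A₀ hA₀ hA₀' hΦd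
    (Prop42Sub.unitRootsUpstairs_of_constantRoots (mkOfModelCanonical X tf hZ hP IG gS gSs NH A₀ hA₀ hA₀')
      (fun φ x => tf.pullFracModel φ x) hΦd (tf.isGroupLike_ratFnFunctor T.isUnit_BΛ) hL)

end Canonical

end BiKummerSetting

end Literature.AnabelianGeometry.EtaleTheta
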